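import Literature.NumberTheory.LFunctions.RieszPerronOrderThree
import HarnessLib

/-!
# Perron's formula of order three shifted across a ZERO of the continued Dirichlet series
# (the zero-detection identity of Montgomery's method, Riesz-mean form)

Topic `Literature/NumberTheory/LFunctions`, sequel to `RieszPerronOrderThree.lean` (whose kernel
bounds, integrability lemmas and Perron formula are reused verbatim).  Everything here is PROVED; no
definitions, no named facts.

Let `c > 0`, `x ≥ 1`, and let `Φ` be ENTIRE with `Φ(0) = 0` and `‖Φ(u)‖ ≤ A (K₁ + |Im u|)²` on the
strip `−η ≤ Re u ≤ c` (`1/5 ≤ η ≤ 1/2`), agreeing on `Re u = c` with an absolutely convergent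
Dirichlet series `L(f, ·)`.  Then

* `integral_right_eq_integral_left` — the line of integration of
  `F(u) = x^{3+u} Φ(u) · 6/(u(u+1)(u+2)(u+3))` may be moved from `Re u = c` to `Re u = −η`: the only
  singularity crossed is the simple pole of the kernel at `u = 0`, whose residue `x³ Φ(0)` VANISHES
  (the tree's residue theorem for vertical strips,
  `Literature.Analysis.Complex.integral_vertical_sub_eq_sum_of_simplePoles`, with residue `0`);
* `sum_mul_sub_cube_eq_integral_left` — hence **Perron's formula of order three on the line
  `Re u = −η`**: `∑_{n ≤ x} f(n)(x − n)³ = (1/2π) ∫ F(−η + it) dt`;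
* `norm_integral_left_le` — and `‖∫ F(−η + it) dt‖ ≤ 60000 · x^{3−η} ∫ ‖Φ(−η + it)‖ (1 + |t|)⁻⁴ dt`
  (the kernel is `≤ 96 · 5⁴ (1 + |t|)⁻⁴` on that line).

Model (the consumer, the zero-detection step of the proof of Ricci's zero-density estimate for the
Hecke `L`-functions of `ℚ(i)`, `GaussianHecke.ricci_zeroDensity`): `ρ = β + iγ` a zero of `D_m`
with `7/10 ≤ β ≤ 1`, `Φ(u) = D_m(ρ + u) M_X(ρ + u)` (mollified), `η = β − 1/2`, `f(n) = a(n) n^{-ρ}` with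
`a = c_m ⋆ μ_{m,X}` (`a(1) = 1`, `a(n) = 0` for `1 < n ≤ X`): the identity exhibits every such zero as
"class I" (the Dirichlet polynomial `∑_{X < n ≤ x} a(n) n^{-ρ}(1 − n/x)³` is large) or "class II" (the
integral of `|D_m M_X|` along `Re s = 1/2` against `(1 + |t − γ|)⁻⁴` is large).

## References

* H. L. Montgomery, *Topics in Multiplicative Number Theory*, LNM 227 (1971), Ch. 12 (zero-detection).
  [Montgomery1971]
* H. L. Montgomery, R. C. Vaughan, *Multiplicative Number Theory I*, CUP 2007, §5.1 (5.19).
  [MontgomeryVaughan2007]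
* E. C. Titchmarsh, *The Theory of the Riemann Zeta-Function*, 2nd ed. (1986), §9.16–9.18.
  [Titchmarsh1986]
-/

noncomputable section

open Complex Filter Set MeasureTheory Real
open scoped Topology

namespace Literature.NumberTheory.LFunctions

namespace RieszPerron3

/-- `‖Φ(−η + it)‖ (1 + |t|)⁻⁴` is integrable when `‖Φ(−η + it)‖ ≤ A (K₁ + |t|)²`, `Φ` continuous.
[folklore] -/
theorem integrable_norm_mul_inv_pow_four {Φ : ℂ → ℂ} (hΦc : Continuous Φ) {σ' A K₁ : ℝ} (hA : 0 ≤ A)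
    (hK₁ : 1 ≤ K₁) (hΦ : ∀ t : ℝ, ‖Φ ((σ' : ℂ) + t * I)‖ ≤ A * (K₁ + |t|) ^ 2) :
    Integrable fun t : ℝ ↦ ‖Φ ((σ' : ℂ) + t * I)‖ * ((1 + |t|) ^ 4)⁻¹ := by
  have hc : Continuous fun t : ℝ ↦ ‖Φ ((σ' : ℂ) + t * I)‖ * ((1 + |t|) ^ 4)⁻¹ := by
    refine (continuous_norm.comp (hΦc.comp (by fun_prop))).mul ?_
    refine Continuous.inv₀ (by fun_prop) fun t ↦ by positivity
  refine ((integrable_inv_one_add_sq.const_mul (A * K₁ ^ 2))).mono' hc.aestronglyMeasurable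
    (Eventually.of_forall fun t ↦ ?_)
  rw [Real.norm_of_nonneg (by positivity)]
  have h1t : 0 < 1 + |t| := by positivity
  have hKt : (K₁ + |t|) ^ 2 ≤ K₁ ^ 2 * (1 + |t|) ^ 2 := by
    have := add_abs_le_mul (t := t) hK₁
    calc (K₁ + |t|) ^ 2 ≤ (K₁ * (1 + |t|)) ^ 2 := pow_le_pow_left₀ (by positivity) this 2
      _ = K₁ ^ 2 * (1 + |t|) ^ 2 := by ring
  have hsq : 1 + t ^ 2 ≤ (1 + |t|) ^ 2 := by rw [← sq_abs t]; nlinarith [abs_nonneg t]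
  calc ‖Φ ((σ' : ℂ) + t * I)‖ * ((1 + |t|) ^ 4)⁻¹ ≤ A * (K₁ ^ 2 * (1 + |t|) ^ 2) * ((1 + |t|) ^ 4)⁻¹ :=
        mul_le_mul_of_nonneg_right ((hΦ t).trans (mul_le_mul_of_nonneg_left hKt hA)) (by positivity)
    _ = A * K₁ ^ 2 * ((1 + |t|) ^ 2)⁻¹ := by field_simp
    _ ≤ A * K₁ ^ 2 * (1 + t ^ 2)⁻¹ :=
        mul_le_mul_of_nonneg_left (inv_anti₀ (by positivity) hsq) (by positivity)

set_option maxHeartbeats 800000 in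
/-- **Moving the line across a zero.**  Let `c > 0`, `1/5 ≤ η ≤ 1/2`, `x ≥ 1`, `A ≥ 0`, `K₁ ≥ 1`, and let
`Φ` be entire with `Φ(0) = 0` and `‖Φ(u)‖ ≤ A (K₁ + |Im u|)²` for `−η ≤ Re u ≤ c`.  Then for
`F(u) = x^{3+u} Φ(u) · 6/(u(u+1)(u+2)(u+3))`: `∫ F(c + it) dt = ∫ F(−η + it) dt` (residue theorem on
the strip; the kernel's pole at `u = 0` has residue `x³ Φ(0) = 0`, the poles `−1, −2, −3` lie left of
the strip). [cite: Montgomery1971, Ch. 12] -/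
theorem integral_right_eq_integral_left {Φ : ℂ → ℂ} (hΦd : Differentiable ℂ Φ) (hΦ0 : Φ 0 = 0)
    {c : ℝ} (hc : 0 < c) {η : ℝ} (hη : 1 / 5 ≤ η) (hη2 : η ≤ 1 / 2) {x : ℝ} (hx : 1 ≤ x)
    {A K₁ : ℝ} (hA : 0 ≤ A) (hK₁ : 1 ≤ K₁)
    (hbound : ∀ u : ℂ, -η ≤ u.re → u.re ≤ c → ‖Φ u‖ ≤ A * (K₁ + |u.im|) ^ 2) :
    (∫ t : ℝ, (x : ℂ) ^ (3 + ((c : ℂ) + t * I)) * Φ ((c : ℂ) + t * I) *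
        (6 / (((c : ℂ) + t * I) * ((c : ℂ) + t * I + 1) * ((c : ℂ) + t * I + 2) * ((c : ℂ) + t * I + 3)))) =
      ∫ t : ℝ, (x : ℂ) ^ (3 + (((-η : ℝ) : ℂ) + t * I)) * Φ (((-η : ℝ) : ℂ) + t * I) *
        (6 / ((((-η : ℝ) : ℂ) + t * I) * (((-η : ℝ) : ℂ) + t * I + 1) * (((-η : ℝ) : ℂ) + t * I + 2) *
          (((-η : ℝ) : ℂ) + t * I + 3))) := by
  have hx0 : 0 < x := by linarith
  have hxC : (x : ℂ) ≠ 0 := ofReal_ne_zero.2 hx0.ne'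
  have hΦc : Continuous Φ := hΦd.continuous
  set F : ℂ → ℂ := fun u ↦ (x : ℂ) ^ (3 + u) * Φ u * (6 / (u * (u + 1) * (u + 2) * (u + 3))) with hFdef
  -- distances to the poles on the two lines
  set δ : ℝ := min c (1 / 5) with hδdef
  have hδ0 : 0 < δ := by rw [hδdef]; exact lt_min hc (by norm_num)
  have hδc : δ ≤ c := min_le_left _ _
  have hδ5 : δ ≤ 1 / 5 := min_le_right _ _
  have hδ1 : δ ≤ 1 := by linarith
  have hr0 : δ ≤ |c| := by rw [abs_of_pos hc]; exact hδc
  have hr1 : δ ≤ |c + 1| := by rw [abs_of_pos (by linarith)]; linarith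
  have hr2 : δ ≤ |c + 2| := by rw [abs_of_pos (by linarith)]; linarith
  have hr3 : δ ≤ |c + 3| := by rw [abs_of_pos (by linarith)]; linarith
  have hl0 : δ ≤ |(-η : ℝ)| := by rw [abs_of_neg (by linarith)]; linarith
  have hl1 : δ ≤ |(-η : ℝ) + 1| := by rw [abs_of_pos (by linarith)]; linarith
  have hl2 : δ ≤ |(-η : ℝ) + 2| := by rw [abs_of_pos (by linarith)]; linarith
  have hl3 : δ ≤ |(-η : ℝ) + 3| := by rw [abs_of_pos (by linarith)]; linarith
  have hΦr : ∀ t : ℝ, ‖Φ ((c : ℂ) + t * I)‖ ≤ A * (K₁ + |t|) ^ 2 := fun t ↦ by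
    have := hbound ((c : ℂ) + t * I) (by simp; linarith) (by simp)
    simpa using this
  have hΦl : ∀ t : ℝ, ‖Φ (((-η : ℝ) : ℂ) + t * I)‖ ≤ A * (K₁ + |t|) ^ 2 := fun t ↦ by
    have := hbound (((-η : ℝ) : ℂ) + t * I) (by simp) (by simp; linarith)
    simpa using this
  have hint_r : Integrable fun t : ℝ ↦ F ((c : ℂ) + t * I) :=
    integrable_integrand hΦc hx0 hδ0 hδ1 hr0 hr1 hr2 hr3 hA hK₁ hΦr
  have hint_l : Integrable fun t : ℝ ↦ F (((-η : ℝ) : ℂ) + t * I) :=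
    integrable_integrand hΦc hx0 hδ0 hδ1 hl0 hl1 hl2 hl3 hA hK₁ hΦl
  -- the residue theorem on the strip `-η ≤ Re u ≤ c`
  set U : Set ℂ := {u : ℂ | -3 / 4 < u.re} with hUdef
  have hU : IsOpen U := isOpen_lt continuous_const Complex.continuous_re
  have hKU : re ⁻¹' Icc (-η : ℝ) c ⊆ U := fun u hu ↦ by
    simp only [hUdef, Set.mem_setOf_eq]
    have := hu.1
    linarith
  have hS : ∀ p ∈ ({0} : Finset ℂ), p.re ∈ Ioo (-η : ℝ) c := by
    intro p hp
    rw [Finset.mem_singleton] at hp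
    rw [hp, Complex.zero_re, Set.mem_Ioo]
    constructor <;> linarith
  have hden_ne : ∀ u ∈ U, u ≠ 0 → u * (u + 1) * (u + 2) * (u + 3) ≠ 0 := by
    intro u hu hu0
    simp only [hUdef, Set.mem_setOf_eq] at hu
    have n1 : u + 1 ≠ 0 := fun h ↦ by have := congrArg Complex.re h; simp at this; linarith
    have n2 : u + 2 ≠ 0 := fun h ↦ by have := congrArg Complex.re h; simp at this; linarith
    have n3 : u + 3 ≠ 0 := fun h ↦ by have := congrArg Complex.re h; simp at this; linarith
    exact mul_ne_zero (mul_ne_zero (mul_ne_zero hu0 n1) n2) n3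
  have hFdiff : DifferentiableOn ℂ F (U \ ↑({0} : Finset ℂ)) := by
    intro u hu
    obtain ⟨hu1, hu2⟩ := hu
    have hu0 : u ≠ 0 := by simpa using hu2
    have hd := hden_ne u hu1 hu0
    refine DifferentiableAt.differentiableWithinAt ?_
    refine ((DifferentiableAt.const_cpow (by fun_prop) (Or.inl hxC)).mul (hΦd u)).mul ?_
    exact (differentiableAt_const _).div (by fun_prop) hd
  set φ : ℂ → ℂ := fun u ↦ (x : ℂ) ^ (3 + u) * Φ u * (6 / ((u + 1) * (u + 2) * (u + 3))) with hφdef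
  have hpole : ∀ p ∈ ({0} : Finset ℂ), ∃ φ' : ℂ → ℂ, ∃ V ∈ 𝓝 p, DifferentiableOn ℂ φ' V ∧
      φ' p = (fun _ : ℂ ↦ (0 : ℂ)) p ∧ ∀ z ∈ V, z ≠ p → F z = φ' z / (z - p) := by
    intro p hp
    rw [Finset.mem_singleton] at hp
    subst hp
    refine ⟨φ, Metric.ball 0 (1 / 2), Metric.ball_mem_nhds _ (by norm_num), ?_, ?_, ?_⟩
    · intro u hu
      have hu' : ‖u‖ < 1 / 2 := by simpa using hu
      have hre : |u.re| < 1 / 2 := lt_of_le_of_lt (Complex.abs_re_le_norm u) hu'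
      rw [abs_lt] at hre
      have n1 : u + 1 ≠ 0 := fun h ↦ by have := congrArg Complex.re h; simp at this; linarith
      have n2 : u + 2 ≠ 0 := fun h ↦ by have := congrArg Complex.re h; simp at this; linarith
      have n3 : u + 3 ≠ 0 := fun h ↦ by have := congrArg Complex.re h; simp at this; linarith
      refine DifferentiableAt.differentiableWithinAt ?_
      refine ((DifferentiableAt.const_cpow (by fun_prop) (Or.inl hxC)).mul (hΦd u)).mul ?_
      exact (differentiableAt_const _).div (by fun_prop) (mul_ne_zero (mul_ne_zero n1 n2) n3)
    · simp only [hφdef, hΦ0, mul_zero, zero_mul]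
    · intro z hz hz0
      rw [sub_zero]
      have hz' : ‖z‖ < 1 / 2 := by simpa using hz
      have hre : |z.re| < 1 / 2 := lt_of_le_of_lt (Complex.abs_re_le_norm z) hz'
      rw [abs_lt] at hre
      have n1 : z + 1 ≠ 0 := fun h ↦ by have := congrArg Complex.re h; simp at this; linarith
      have n2 : z + 2 ≠ 0 := fun h ↦ by have := congrArg Complex.re h; simp at this; linarith
      have n3 : z + 3 ≠ 0 := fun h ↦ by have := congrArg Complex.re h; simp at this; linarith
      simp only [hFdef, hφdef]
      field_simp
  -- decay on horizontal segments
  have hdecay : ∀ ε : ℝ, 0 < ε → ∃ T₀ : ℝ, ∀ T : ℝ, T₀ ≤ |T| → ∀ y ∈ Icc (-η : ℝ) c,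
      ‖F (y + T * I)‖ ≤ ε := by
    intro ε hε
    set B : ℝ := 24 * x ^ (3 + c) * A * K₁ ^ 2 with hBdef
    have hB0 : 0 ≤ B := by rw [hBdef]; have := Real.rpow_nonneg hx0.le (3 + c); positivity
    refine ⟨max 1 (Real.sqrt (B / ε) + 1), fun T hT y hy ↦ ?_⟩
    have hT1 : 1 ≤ |T| := le_trans (le_max_left _ _) hT
    have hTs : Real.sqrt (B / ε) < |T| := lt_of_lt_of_le (by linarith [le_max_right 1 (Real.sqrt (B / ε) + 1)]) hT
    have hT0 : 0 < |T| := by linarith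
    obtain ⟨hy1, hy2⟩ := hy
    set u : ℂ := (y : ℂ) + T * I with hudef
    have him : u.im = T := by simp [hudef]
    have hfac : ∀ j : ℝ, |T| ≤ ‖u + j‖ := fun j ↦ by
      have := Complex.abs_im_le_norm (u + j); simpa [hudef] using this
    have hk : ‖(6 : ℂ) / (u * (u + 1) * (u + 2) * (u + 3))‖ ≤ 6 / |T| ^ 4 := by
      have g0 := hfac 0; have g1 := hfac 1; have g2 := hfac 2; have g3 := hfac 3
      simp only [ofReal_zero, add_zero] at g0
      simp only [ofReal_one] at g1
      rw [show ((2 : ℝ) : ℂ) = 2 by norm_num] at g2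
      rw [show ((3 : ℝ) : ℂ) = 3 by norm_num] at g3
      have hprod : |T| ^ 4 ≤ ‖u * (u + 1) * (u + 2) * (u + 3)‖ := by
        rw [norm_mul, norm_mul, norm_mul]
        calc |T| ^ 4 = |T| * |T| * |T| * |T| := by ring
          _ ≤ ‖u‖ * ‖u + 1‖ * ‖u + 2‖ * ‖u + 3‖ := by
              apply mul_le_mul (mul_le_mul (mul_le_mul g0 g1 hT0.le (norm_nonneg _)) g2 hT0.le (by positivity))
                g3 hT0.le (by positivity)
      have hpos : 0 < ‖u * (u + 1) * (u + 2) * (u + 3)‖ := lt_of_lt_of_le (by positivity) hprod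
      rw [norm_div, show ‖(6 : ℂ)‖ = 6 by simp, div_le_div_iff₀ hpos (by positivity)]
      nlinarith
    have hxu : ‖(x : ℂ) ^ (3 + u)‖ ≤ x ^ (3 + c) := by
      rw [norm_cpow_eq_rpow_re_of_pos hx0]
      refine Real.rpow_le_rpow_of_exponent_le hx ?_
      simp [hudef]; exact hy2
    have hΦu : ‖Φ u‖ ≤ A * (K₁ ^ 2 * (4 * |T| ^ 2)) := by
      have h1 := hbound u (by simp [hudef]; exact hy1) (by simp [hudef]; exact hy2)
      rw [him] at h1
      refine h1.trans (mul_le_mul_of_nonneg_left ?_ hA)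
      have h2 := add_abs_le_mul (t := T) hK₁
      calc (K₁ + |T|) ^ 2 ≤ (K₁ * (1 + |T|)) ^ 2 := pow_le_pow_left₀ (by positivity) h2 2
        _ = K₁ ^ 2 * (1 + |T|) ^ 2 := by ring
        _ ≤ K₁ ^ 2 * (4 * |T| ^ 2) := by
            refine mul_le_mul_of_nonneg_left ?_ (by positivity)
            nlinarith
    calc ‖F u‖ = ‖(x : ℂ) ^ (3 + u)‖ * ‖Φ u‖ * ‖(6 : ℂ) / (u * (u + 1) * (u + 2) * (u + 3))‖ := by
          rw [hFdef]; simp only [norm_mul]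
      _ ≤ x ^ (3 + c) * (A * (K₁ ^ 2 * (4 * |T| ^ 2))) * (6 / |T| ^ 4) := by
          gcongr
      _ = B / |T| ^ 2 := by
          rw [hBdef]; field_simp; ring
      _ ≤ ε := by
          rw [div_le_iff₀ (by positivity)]
          have hsq : B / ε < |T| ^ 2 := by
            have h1 : Real.sqrt (B / ε) ^ 2 = B / ε := Real.sq_sqrt (by positivity)
            have h2 : Real.sqrt (B / ε) ^ 2 < |T| ^ 2 := by
              exact pow_lt_pow_left₀ hTs (Real.sqrt_nonneg _) two_ne_zero
            linarith
          rw [div_lt_iff₀ hε] at hsq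
          linarith
  have hres := Literature.Analysis.Complex.integral_vertical_sub_eq_sum_of_simplePoles (F := F)
    (a := -η) (b := c) (by linarith) ({0} : Finset ℂ) (fun _ : ℂ ↦ (0 : ℂ)) U hU hKU hS
    hFdiff hpole hint_l hint_r hdecay
  rw [Finset.sum_singleton, mul_zero, sub_eq_zero] at hres
  exact hres

/-- **Perron's formula of order three on the line `Re u = −η` through the strip of a zero**: under the
hypotheses of `integral_right_eq_integral_left`, if moreover `∑ f(n) n^{-c}` converges absolutely with
`L(f, c + it) = Φ(c + it)`, then
`∑_{n ≤ x} f(n) (x − n)³ = (1/2π) ∫ x^{3−η+it} Φ(−η + it) · 6 dt/((−η+it)(1−η+it)(2−η+it)(3−η+it))`.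
[cite: MontgomeryVaughan2007, §5.1 (5.19)] -/
theorem sum_mul_sub_cube_eq_integral_left (f : ℕ → ℂ) {Φ : ℂ → ℂ} (hΦd : Differentiable ℂ Φ)
    (hΦ0 : Φ 0 = 0) {c : ℝ} (hc : 0 < c) {η : ℝ} (hη : 1 / 5 ≤ η) (hη2 : η ≤ 1 / 2) {x : ℝ} (hx : 1 ≤ x)
    {A K₁ : ℝ} (hA : 0 ≤ A) (hK₁ : 1 ≤ K₁)
    (hbound : ∀ u : ℂ, -η ≤ u.re → u.re ≤ c → ‖Φ u‖ ≤ A * (K₁ + |u.im|) ^ 2)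
    (hsum : LSeriesSummable f c) (hL : ∀ t : ℝ, LSeries f (c + t * I) = Φ (c + t * I)) :
    ∑ n ∈ Finset.Ioc 0 ⌊x⌋₊, f n * ((x : ℂ) - n) ^ 3 =
      (1 / (2 * π) : ℂ) * ∫ t : ℝ, (x : ℂ) ^ (3 + (((-η : ℝ) : ℂ) + t * I)) * Φ (((-η : ℝ) : ℂ) + t * I) *
        (6 / ((((-η : ℝ) : ℂ) + t * I) * (((-η : ℝ) : ℂ) + t * I + 1) * (((-η : ℝ) : ℂ) + t * I + 2) *
          (((-η : ℝ) : ℂ) + t * I + 3))) := by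
  have hx0 : 0 < x := by linarith
  rw [sum_mul_sub_cube_eq_integral_LSeries f hx0 hc hsum, ← integral_right_eq_integral_left hΦd hΦ0 hc hη
    hη2 hx hA hK₁ hbound]
  congr 1
  refine integral_congr_ae (Eventually.of_forall fun t ↦ ?_)
  simp only [hL t]

/-- **The size of the shifted integral**: on `Re u = −η` (`1/5 ≤ η ≤ 1/2`) the kernel is
`≤ 96 · 5⁴ (1 + |t|)⁻⁴` and `|x^{3+u}| = x^{3−η}`, so
`‖∫ F(−η + it) dt‖ ≤ 60000 · x^{3−η} ∫ ‖Φ(−η + it)‖ (1 + |t|)⁻⁴ dt` (the right side converging by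
the growth bound). [folklore] -/
theorem norm_integral_left_le {Φ : ℂ → ℂ} (hΦc : Continuous Φ) {η : ℝ} (hη : 1 / 5 ≤ η) (hη2 : η ≤ 1 / 2)
    {x : ℝ} (hx : 1 ≤ x) {A K₁ : ℝ} (hA : 0 ≤ A) (hK₁ : 1 ≤ K₁)
    (hΦl : ∀ t : ℝ, ‖Φ (((-η : ℝ) : ℂ) + t * I)‖ ≤ A * (K₁ + |t|) ^ 2) :
    ‖∫ t : ℝ, (x : ℂ) ^ (3 + (((-η : ℝ) : ℂ) + t * I)) * Φ (((-η : ℝ) : ℂ) + t * I) *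
        (6 / ((((-η : ℝ) : ℂ) + t * I) * (((-η : ℝ) : ℂ) + t * I + 1) * (((-η : ℝ) : ℂ) + t * I + 2) *
          (((-η : ℝ) : ℂ) + t * I + 3)))‖ ≤
      60000 * x ^ (3 - η) * ∫ t : ℝ, ‖Φ (((-η : ℝ) : ℂ) + t * I)‖ * ((1 + |t|) ^ 4)⁻¹ := by
  have hx0 : 0 < x := by linarith
  have hq0 : (0 : ℝ) < 1 / 5 := by norm_num
  have hq1 : (1 / 5 : ℝ) ≤ 1 := by norm_num
  have k0 : (1 / 5 : ℝ) ≤ |(-η : ℝ)| := by rw [abs_of_neg (by linarith)]; linarith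
  have k1 : (1 / 5 : ℝ) ≤ |(-η : ℝ) + 1| := by rw [abs_of_pos (by linarith)]; linarith
  have k2 : (1 / 5 : ℝ) ≤ |(-η : ℝ) + 2| := by rw [abs_of_pos (by linarith)]; linarith
  have k3 : (1 / 5 : ℝ) ≤ |(-η : ℝ) + 3| := by rw [abs_of_pos (by linarith)]; linarith
  have hint_l := integrable_integrand (x := x) hΦc hx0 hq0 hq1 k0 k1 k2 k3 hA hK₁ hΦl
  have hI := integrable_norm_mul_inv_pow_four hΦc hA hK₁ hΦl
  calc ‖∫ t : ℝ, (x : ℂ) ^ (3 + (((-η : ℝ) : ℂ) + t * I)) * Φ (((-η : ℝ) : ℂ) + t * I) *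
        (6 / ((((-η : ℝ) : ℂ) + t * I) * (((-η : ℝ) : ℂ) + t * I + 1) * (((-η : ℝ) : ℂ) + t * I + 2) *
          (((-η : ℝ) : ℂ) + t * I + 3)))‖
      ≤ ∫ t : ℝ, ‖(x : ℂ) ^ (3 + (((-η : ℝ) : ℂ) + t * I)) * Φ (((-η : ℝ) : ℂ) + t * I) *
        (6 / ((((-η : ℝ) : ℂ) + t * I) * (((-η : ℝ) : ℂ) + t * I + 1) * (((-η : ℝ) : ℂ) + t * I + 2) *
          (((-η : ℝ) : ℂ) + t * I + 3)))‖ := norm_integral_le_integral_norm _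
    _ ≤ ∫ t : ℝ, 60000 * x ^ (3 - η) * (‖Φ (((-η : ℝ) : ℂ) + t * I)‖ * ((1 + |t|) ^ 4)⁻¹) := by
        refine integral_mono hint_l.norm (hI.const_mul _) fun t ↦ ?_
        have hk := norm_kernel_le (s := ((-η : ℝ) : ℂ) + t * I) hq0 hq1 (by simpa using k0) (by simpa using k1)
          (by simpa using k2) (by simpa using k3)
        simp only [add_im, ofReal_im, mul_im, ofReal_re, I_im, mul_one, I_re, mul_zero, add_zero,
          zero_add] at hk
        rw [norm_mul, norm_mul, norm_cpow_eq_rpow_re_of_pos hx0]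
        simp only [add_re, re_ofNat, ofReal_re, mul_re, I_re, mul_zero, ofReal_im, I_im, mul_one,
          sub_self, add_zero]
        have hxp : 0 ≤ x ^ (3 + -η) := Real.rpow_nonneg hx0.le _
        have hΦ0 : 0 ≤ ‖Φ (((-η : ℝ) : ℂ) + t * I)‖ := norm_nonneg _
        have h1t : 0 < (1 + |t|) ^ 4 := by positivity
        calc x ^ (3 + -η) * ‖Φ (((-η : ℝ) : ℂ) + t * I)‖ *
              ‖(6 : ℂ) / ((((-η : ℝ) : ℂ) + t * I) * (((-η : ℝ) : ℂ) + t * I + 1) *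
                (((-η : ℝ) : ℂ) + t * I + 2) * (((-η : ℝ) : ℂ) + t * I + 3))‖
            ≤ x ^ (3 + -η) * ‖Φ (((-η : ℝ) : ℂ) + t * I)‖ * (96 / ((1 / 5 : ℝ) ^ 4 * (1 + |t|) ^ 4)) :=
              mul_le_mul_of_nonneg_left hk (mul_nonneg hxp hΦ0)
          _ = 60000 * x ^ (3 - η) * (‖Φ (((-η : ℝ) : ℂ) + t * I)‖ * ((1 + |t|) ^ 4)⁻¹) := by
              rw [show (3 : ℝ) + -η = 3 - η by ring]
              field_simp
              ring
    _ = 60000 * x ^ (3 - η) * ∫ t : ℝ, ‖Φ (((-η : ℝ) : ℂ) + t * I)‖ * ((1 + |t|) ^ 4)⁻¹ :=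
        integral_const_mul _ _

end RieszPerron3

end Literature.NumberTheory.LFunctions
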